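import Summits.QuantumAdvantage.QuantumAdvantage.Theorems.LinnikCubicClassGroupsDegreeOnePrimesEscapeConjClassShortIntervalDHRelative
import Summits.QuantumAdvantage.QuantumAdvantage.Theorems.LinnikCubicClassGroupsDegreeOnePrimesEscapeConjClassShortIntervalDHCorollaries
import HarnessLib

/-!
# The Chebotarev density theorem in short intervals over an arbitrary base: the prime-count form

Topic `Summits/QuantumAdvantage/QuantumAdvantage/Theorems`, cell B2b-1 (linnik-cubic), PART A (gen 19); helper toward the
crux `DegreeOnePrimesEscape` (stmt-QuantumAdvantage-11543) of route `LinnikCubicClassGroups`.  HONEST FRAMING: the value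
of this file is a THEOREM (kernel-checked, GRH-free, Siegel-free) — NOT summit progress.

`frobeniusClass_shortInterval_count_relative`: the prime-count form of `frobeniusClass_shortInterval_dh_relative`.  For
`n > 1`, `κ > 0` there are `δ ≤ 1/64`, `L`, `c` such that for every Galois extension `N/F` of number fields with `[N:ℚ] = n`,
every `σ ∈ Gal(N/F)`, `x ≥ |d_N|^L`, `x^{1−δ} ≤ h ≤ x`, with `N_C(x, h)` the number of degree-one primes `𝔮` of `F`
(`N𝔮 = p ∤ d_N` prime) with `x < N𝔮 ≤ x + h` and `Frob_𝔮 ∈ C(σ)`, `δ_C = |C|/|Gal(N/F)|`, `I = ∫_x^{x+h} t^{β₁−1} dt`: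
(A) no real zero of `ζ_N` in `(1 − c/(log|d_N| + log 4), 1)` ⟹ `|N_C log x − δ_C h| ≤ κ δ_C h`;
(B) `β₁` such a zero ⟹ `|N_C log x − δ_C (h − I)| ≤ κ δ_C (h − I)` if `ζ_{N^⟨σ⟩}(β₁) = 0`, and
`|N_C log x − δ_C (h + I)| ≤ κ δ_C h` otherwise.  Unconditional; arbitrary base `F`.
References: A. Balog, K. Ono, J. Number Theory 91 (2001); [LagariasMontgomeryOdlyzko1979, Thm. 1.1]; [ThornerZaman2019, Thm. 3.1].
-/

noncomputable section

open scoped NumberField nonZeroDivisors Classical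
open Finset Real Ideal NumberField IsDedekindDomain
open Literature.NumberTheory.NumberFields Literature.NumberTheory.LFunctions
  Literature.NumberTheory.LFunctions.NumberField Literature.NumberTheory.GaloisRepresentations

namespace Summit.QuantumAdvantage.QuantumAdvantage.Theorems.DegreeOnePrimesEscape

/-! ### `log N𝔮`-weighted prime-ideal sums versus counts over `(x, x+h]` -/

/-- For a predicate `P` on the prime ideals of `F`, `0 < x`, `0 ≤ h`: with `S(y) = Σ_{N𝔮 ≤ y, P 𝔮} log N𝔮` and
`N(y) = #{𝔮 : N𝔮 ≤ y, P 𝔮}`, `(N(x+h) − N(x))·log x ≤ S(x+h) − S(x) ≤ (N(x+h) − N(x))·log(x+h)`. [folklore] -/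
theorem primeIdealsLE_logSum_sub_mem {F : Type} [Field F] [NumberField F] {P : Ideal (𝓞 F) → Prop} [DecidablePred P]
    {x h : ℝ} (hx : 0 < x) (hh : 0 ≤ h) :
    ((((finite_primeIdealsLE F (x + h)).toFinset.filter P).card : ℝ) - ((finite_primeIdealsLE F x).toFinset.filter P).card) *
          Real.log x ≤
        (∑ q ∈ (finite_primeIdealsLE F (x + h)).toFinset.filter P, Real.log (Ideal.absNorm q : ℝ)) -
          ∑ q ∈ (finite_primeIdealsLE F x).toFinset.filter P, Real.log (Ideal.absNorm q : ℝ) ∧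
      (∑ q ∈ (finite_primeIdealsLE F (x + h)).toFinset.filter P, Real.log (Ideal.absNorm q : ℝ)) -
          ∑ q ∈ (finite_primeIdealsLE F x).toFinset.filter P, Real.log (Ideal.absNorm q : ℝ) ≤
        ((((finite_primeIdealsLE F (x + h)).toFinset.filter P).card : ℝ) - ((finite_primeIdealsLE F x).toFinset.filter P).card) *
          Real.log (x + h) := by
  set S := (finite_primeIdealsLE F x).toFinset.filter P with hS
  set T := (finite_primeIdealsLE F (x + h)).toFinset.filter P with hT
  have hsub : S ⊆ T := by
    intro q hq
    rw [hS, Finset.mem_filter, mem_primeIdealsLE_toFinset] at hq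
    rw [hT, Finset.mem_filter, mem_primeIdealsLE_toFinset]
    exact ⟨⟨hq.1.1, hq.1.2.1, hq.1.2.2.trans (by linarith)⟩, hq.2⟩
  have hcard : ((T \ S).card : ℝ) = (T.card : ℝ) - S.card := by
    rw [Finset.card_sdiff_of_subset hsub, Nat.cast_sub (Finset.card_le_card hsub)]
  rw [← Finset.sum_sdiff hsub, add_sub_cancel_right, ← hcard]
  have hmem : ∀ q ∈ T \ S, x < (Ideal.absNorm q : ℝ) ∧ (Ideal.absNorm q : ℝ) ≤ x + h := by
    intro q hq
    rw [Finset.mem_sdiff, hT, Finset.mem_filter, mem_primeIdealsLE_toFinset] at hq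
    obtain ⟨⟨⟨hqP, hq0, hqle⟩, hPq⟩, hnot⟩ := hq
    refine ⟨?_, hqle⟩
    by_contra hle
    rw [not_lt] at hle
    exact hnot (by rw [hS, Finset.mem_filter, mem_primeIdealsLE_toFinset]; exact ⟨⟨hqP, hq0, hle⟩, hPq⟩)
  constructor
  · have h := Finset.card_nsmul_le_sum (T \ S) (fun q : Ideal (𝓞 F) ↦ Real.log (Ideal.absNorm q : ℝ)) (Real.log x)
      (fun q hq ↦ ?_)
    · rwa [nsmul_eq_mul] at h
    · exact Real.log_le_log hx (hmem q hq).1.le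
  · have h := Finset.sum_le_card_nsmul (T \ S) (fun q : Ideal (𝓞 F) ↦ Real.log (Ideal.absNorm q : ℝ)) (Real.log (x + h))
      (fun q hq ↦ ?_)
    · rwa [nsmul_eq_mul] at h
    · exact Real.log_le_log (by linarith [(hmem q hq).1]) (hmem q hq).2

set_option maxHeartbeats 3200000 in
/-- **The Chebotarev density theorem in short intervals of the Linnik range, prime-count form, Deuring–Heilbronn-sharp,
every conjugacy class of every Galois extension `N/F` over an ARBITRARY base number field `F`** (see the module docstring).
Unconditional. [cite: LagariasMontgomeryOdlyzko1979, Theorem 1.1] [cite: ThornerZaman2019, Theorem 3.1] -/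
theorem frobeniusClass_shortInterval_count_relative (n : ℕ) (hn : 1 < n) {κ : ℝ} (hκ : 0 < κ) :
    ∃ δ L c : ℝ, 0 < δ ∧ δ ≤ 1 / 64 ∧ 0 < L ∧ 0 < c ∧ c ≤ 1 / 4 ∧ c ≤ 1 / (8 * ((2 * n).factorial : ℝ)) ∧
      ∀ (F N : Type) [Field F] [NumberField F] [Field N] [NumberField N] [Algebra F N] [IsGalois F N],
      Module.finrank ℚ N = n → ∀ σ : N ≃ₐ[F] N,
      ∀ x h : ℝ, ((NumberField.discr N).natAbs : ℝ) ^ L ≤ x → x ^ (1 - δ) ≤ h → h ≤ x →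
        ((¬ ∃ β₁ : ℝ, dedekindZeta₁ N β₁ = 0 ∧
            1 - c / (Real.log ((NumberField.discr N).natAbs : ℝ) + Real.log 4) < β₁ ∧ β₁ < 1) →
            |((((finite_primeIdealsLE F (x + h)).toFinset.filter
                 (fun q : Ideal (𝓞 F) => (Ideal.absNorm q).Prime ∧ ¬ ((Ideal.absNorm q : ℤ) ∣ NumberField.discr N) ∧
                 ∃ (Q : Ideal (𝓞 N)) (_ : Q.IsMaximal) (_ : Q.LiesOver q) (φ g : N ≃ₐ[F] N),
                 IsArithFrobAt (𝓞 F) φ Q ∧ Q.inertia (N ≃ₐ[F] N) = ⊥ ∧ g * φ * g⁻¹ = σ)).card : ℝ) -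
              ((finite_primeIdealsLE F x).toFinset.filter
                (fun q : Ideal (𝓞 F) => (Ideal.absNorm q).Prime ∧ ¬ ((Ideal.absNorm q : ℤ) ∣ NumberField.discr N) ∧
                ∃ (Q : Ideal (𝓞 N)) (_ : Q.IsMaximal) (_ : Q.LiesOver q) (φ g : N ≃ₐ[F] N),
                IsArithFrobAt (𝓞 F) φ Q ∧ Q.inertia (N ≃ₐ[F] N) = ⊥ ∧ g * φ * g⁻¹ = σ)).card) * Real.log x -
              (Nat.card {τ : N ≃ₐ[F] N // IsConj σ τ} : ℝ) / Nat.card (N ≃ₐ[F] N) * h| ≤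
              κ * ((Nat.card {τ : N ≃ₐ[F] N // IsConj σ τ} : ℝ) / Nat.card (N ≃ₐ[F] N) * h)) ∧
        (∀ β₁ : ℝ, dedekindZeta₁ N β₁ = 0 →
          1 - c / (Real.log ((NumberField.discr N).natAbs : ℝ) + Real.log 4) < β₁ → β₁ < 1 →
          (dedekindZeta₁ (IntermediateField.fixedField (Subgroup.zpowers σ)) β₁ = 0 →
              |((((finite_primeIdealsLE F (x + h)).toFinset.filter
                   (fun q : Ideal (𝓞 F) => (Ideal.absNorm q).Prime ∧ ¬ ((Ideal.absNorm q : ℤ) ∣ NumberField.discr N) ∧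
                   ∃ (Q : Ideal (𝓞 N)) (_ : Q.IsMaximal) (_ : Q.LiesOver q) (φ g : N ≃ₐ[F] N),
                   IsArithFrobAt (𝓞 F) φ Q ∧ Q.inertia (N ≃ₐ[F] N) = ⊥ ∧ g * φ * g⁻¹ = σ)).card : ℝ) -
                ((finite_primeIdealsLE F x).toFinset.filter
                  (fun q : Ideal (𝓞 F) => (Ideal.absNorm q).Prime ∧ ¬ ((Ideal.absNorm q : ℤ) ∣ NumberField.discr N) ∧
                  ∃ (Q : Ideal (𝓞 N)) (_ : Q.IsMaximal) (_ : Q.LiesOver q) (φ g : N ≃ₐ[F] N),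
                  IsArithFrobAt (𝓞 F) φ Q ∧ Q.inertia (N ≃ₐ[F] N) = ⊥ ∧ g * φ * g⁻¹ = σ)).card) * Real.log x -
                (Nat.card {τ : N ≃ₐ[F] N // IsConj σ τ} : ℝ) / Nat.card (N ≃ₐ[F] N) *
                  (h - ((x + h) ^ β₁ - x ^ β₁) / β₁)| ≤
                κ * ((Nat.card {τ : N ≃ₐ[F] N // IsConj σ τ} : ℝ) / Nat.card (N ≃ₐ[F] N) *
                  (h - ((x + h) ^ β₁ - x ^ β₁) / β₁))) ∧
          (dedekindZeta₁ (IntermediateField.fixedField (Subgroup.zpowers σ)) β₁ ≠ 0 →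
              |((((finite_primeIdealsLE F (x + h)).toFinset.filter
                   (fun q : Ideal (𝓞 F) => (Ideal.absNorm q).Prime ∧ ¬ ((Ideal.absNorm q : ℤ) ∣ NumberField.discr N) ∧
                   ∃ (Q : Ideal (𝓞 N)) (_ : Q.IsMaximal) (_ : Q.LiesOver q) (φ g : N ≃ₐ[F] N),
                   IsArithFrobAt (𝓞 F) φ Q ∧ Q.inertia (N ≃ₐ[F] N) = ⊥ ∧ g * φ * g⁻¹ = σ)).card : ℝ) -
                ((finite_primeIdealsLE F x).toFinset.filter
                  (fun q : Ideal (𝓞 F) => (Ideal.absNorm q).Prime ∧ ¬ ((Ideal.absNorm q : ℤ) ∣ NumberField.discr N) ∧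
                  ∃ (Q : Ideal (𝓞 N)) (_ : Q.IsMaximal) (_ : Q.LiesOver q) (φ g : N ≃ₐ[F] N),
                  IsArithFrobAt (𝓞 F) φ Q ∧ Q.inertia (N ≃ₐ[F] N) = ⊥ ∧ g * φ * g⁻¹ = σ)).card) * Real.log x -
                (Nat.card {τ : N ≃ₐ[F] N // IsConj σ τ} : ℝ) / Nat.card (N ≃ₐ[F] N) *
                  (h + ((x + h) ^ β₁ - x ^ β₁) / β₁)| ≤
                κ * ((Nat.card {τ : N ≃ₐ[F] N // IsConj σ τ} : ℝ) / Nat.card (N ≃ₐ[F] N) * h))) := by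
  -- the `log`-weighted theorem at precision `κ' = min(κ,1)/4`; `log 2 ≤ κ' log x` from `x ≥ 3^L`, `L ≥ 1/κ'`
  set κ' : ℝ := min κ 1 / 4 with hκ'
  have hκ'0 : 0 < κ' := by rw [hκ']; exact div_pos (lt_min hκ one_pos) (by norm_num)
  have hκ'κ : κ' ≤ κ / 4 := by rw [hκ']; exact div_le_div_of_nonneg_right (min_le_left _ _) (by norm_num)
  have hκ'1 : κ' ≤ 1 / 4 := by rw [hκ']; exact div_le_div_of_nonneg_right (min_le_right _ _) (by norm_num)
  obtain ⟨δ, L, c, hδ0, hδ64, hL0, hc0, hc4, hcfac, hmain⟩ :=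
    frobeniusClass_shortInterval_dh_relative n hn hκ'0 (by linarith)
  refine ⟨δ, max L (1 / κ'), c, hδ0, hδ64, lt_max_of_lt_left hL0, hc0, hc4, hcfac,
    fun F N _ _ _ _ _ _ hN σ x h hx hhx hhx' => ?_⟩
  have hN1 : 1 < Module.finrank ℚ N := by rw [hN]; exact hn
  set d : ℝ := ((NumberField.discr N).natAbs : ℝ) with hd
  have hd3 : (3 : ℝ) ≤ d := three_le_natAbs_discr_real N hN1
  have hd1 : (1 : ℝ) ≤ d := by linarith
  have hxL : d ^ L ≤ x := (Real.rpow_le_rpow_of_exponent_le hd1 (le_max_left _ _)).trans hx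
  have hx1 : 1 < x := by
    have h1 : (3 : ℝ) ^ L ≤ d ^ L := Real.rpow_le_rpow (by norm_num) hd3 hL0.le
    have h2 : (1 : ℝ) < (3 : ℝ) ^ L := Real.one_lt_rpow (by norm_num) hL0
    linarith
  have hx0 : 0 < x := by linarith
  have hh0 : 0 < h := lt_of_lt_of_le (Real.rpow_pos_of_pos hx0 _) hhx
  have hlogx0 : 0 < Real.log x := Real.log_pos hx1
  -- `log 2 ≤ κ' log x`
  have hρκ : Real.log 2 ≤ κ' * Real.log x := by
    have h1 := Real.log_le_log (Real.rpow_pos_of_pos (by linarith) _) hx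
    rw [Real.log_rpow (by linarith)] at h1
    have hlog3 : 1 ≤ Real.log d := by
      have : 1 ≤ Real.log 3 := by
        rw [Real.le_log_iff_exp_le (by norm_num)]; have := Real.exp_one_lt_d9; linarith
      exact this.trans (Real.log_le_log (by norm_num) hd3)
    have h2 : 1 / κ' ≤ max L (1 / κ') * Real.log d :=
      le_trans (le_max_right _ _) (le_mul_of_one_le_right (by positivity) hlog3)
    have hlog2 : Real.log 2 < 0.6931471808 := Real.log_two_lt_d9
    have h3 : κ' * (1 / κ') = 1 := by field_simp
    nlinarith
  obtain ⟨hA, hB⟩ := hmain F N hN σ x h hxL hhx hhx'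
  set P : Ideal (𝓞 F) → Prop := fun q : Ideal (𝓞 F) => (Ideal.absNorm q).Prime ∧
    ¬ ((Ideal.absNorm q : ℤ) ∣ NumberField.discr N) ∧
    ∃ (Q : Ideal (𝓞 N)) (_ : Q.IsMaximal) (_ : Q.LiesOver q) (φ g : N ≃ₐ[F] N),
      IsArithFrobAt (𝓞 F) φ Q ∧ Q.inertia (N ≃ₐ[F] N) = ⊥ ∧ g * φ * g⁻¹ = σ with hP
  set Nc : ℝ := ((((finite_primeIdealsLE F (x + h)).toFinset.filter P).card : ℝ) -
    ((finite_primeIdealsLE F x).toFinset.filter P).card) with hNc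
  set ΔS : ℝ := (∑ q ∈ (finite_primeIdealsLE F (x + h)).toFinset.filter P, Real.log (Ideal.absNorm q : ℝ)) -
    ∑ q ∈ (finite_primeIdealsLE F x).toFinset.filter P, Real.log (Ideal.absNorm q : ℝ) with hΔS
  set δC : ℝ := (Nat.card {τ : N ≃ₐ[F] N // IsConj σ τ} : ℝ) / Nat.card (N ≃ₐ[F] N) with hδC
  have hδC0 : 0 < δC := by
    have h1 : 0 < Nat.card {τ : N ≃ₐ[F] N // IsConj σ τ} := by
      haveI : Nonempty {τ : N ≃ₐ[F] N // IsConj σ τ} := ⟨⟨σ, IsConj.refl σ⟩⟩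
      exact Nat.card_pos
    have h2 : 0 < Nat.card (N ≃ₐ[F] N) := Nat.card_pos
    exact div_pos (by exact_mod_cast h1) (by exact_mod_cast h2)
  obtain ⟨hlo, hup⟩ := primeIdealsLE_logSum_sub_mem (P := P) hx0 hh0.le
  rw [← hNc, ← hΔS] at hlo hup
  have hlogxh : Real.log (x + h) ≤ Real.log x + Real.log 2 := by
    have h1 : Real.log (x + h) ≤ Real.log (2 * x) := Real.log_le_log (by linarith) (by linarith)
    rw [Real.log_mul (by norm_num) hx0.ne'] at h1; linarith
  have hNc0 : 0 ≤ Nc := by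
    rw [hNc, sub_nonneg]
    exact_mod_cast Finset.card_le_card (fun q hq ↦ by
      rw [Finset.mem_filter, mem_primeIdealsLE_toFinset] at hq ⊢
      exact ⟨⟨hq.1.1, hq.1.2.1, hq.1.2.2.trans (by linarith)⟩, hq.2⟩)
  have hΔN : ΔS ≤ Nc * Real.log x + Nc * (κ' * Real.log x) := by
    have := mul_le_mul_of_nonneg_left (hlogxh.trans (by linarith : Real.log x + Real.log 2 ≤ Real.log x + κ' * Real.log x)) hNc0
    linarith
  have hsand : ΔS - κ' * ΔS ≤ Nc * Real.log x ∧ Nc * Real.log x ≤ ΔS := by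
    constructor
    · have hΔ0 : 0 ≤ ΔS := le_trans (mul_nonneg hNc0 hlogx0.le) hlo
      nlinarith [mul_nonneg hNc0 hlogx0.le]
    · exact hlo
  refine ⟨fun hno ↦ ?_, fun β₁ hζ hwin hβ1 ↦ ⟨fun hζE ↦ ?_, fun hζE ↦ ?_⟩⟩
  · have key := abs_le.1 (hA hno)
    have hM0 : 0 ≤ δC * h := by positivity
    rw [abs_le]; constructor <;> nlinarith [hsand.1, hsand.2, key.1, key.2, mul_pos hκ (mul_pos hδC0 hh0)]
  · obtain ⟨hflat, -⟩ := hB β₁ hζ hwin hβ1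
    have key := abs_le.1 (hflat hζE)
    set M : ℝ := δC * (h - ((x + h) ^ β₁ - x ^ β₁) / β₁) with hM
    have hβ0 : 0 < β₁ := by
      have hlogd : 0 < Real.log d := Real.log_pos (by linarith)
      have hlog4 : 1 < Real.log 4 := by
        rw [show (4:ℝ) = 2 ^ 2 by norm_num, Real.log_pow]; have := Real.log_two_gt_d9; push_cast; linarith
      have : c / (Real.log d + Real.log 4) ≤ 1 / 4 := by
        rw [div_le_iff₀ (by linarith)]; nlinarith
      linarith
    have hM0 : 0 ≤ M := by
      have hfl := half_min_mul_le_flat hx1.le hh0.le hβ0 hβ1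
      have : 0 ≤ min 1 ((1 - β₁) * Real.log x) :=
        le_min zero_le_one (mul_nonneg (by linarith) (Real.log_nonneg hx1.le))
      rw [hM]; exact mul_nonneg hδC0.le (by nlinarith)
    rw [abs_le]; constructor <;> nlinarith [hsand.1, hsand.2, key.1, key.2, mul_nonneg hκ.le hM0]
  · obtain ⟨-, hplus⟩ := hB β₁ hζ hwin hβ1
    have key := abs_le.1 (hplus hζE)
    have hβ0 : 0 < β₁ := by
      have hlogd : 0 < Real.log d := Real.log_pos (by linarith)
      have hlog4 : 1 < Real.log 4 := by
        rw [show (4:ℝ) = 2 ^ 2 by norm_num, Real.log_pow]; have := Real.log_two_gt_d9; push_cast; linarith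
      have : c / (Real.log d + Real.log 4) ≤ 1 / 4 := by
        rw [div_le_iff₀ (by linarith)]; nlinarith
      linarith
    obtain ⟨hI0, hIh⟩ := rpow_window_div_mem hx1.le hh0.le hβ0 hβ1.le
    have hI0' : 0 ≤ δC * (((x + h) ^ β₁ - x ^ β₁) / β₁) := mul_nonneg hδC0.le hI0
    have hIh' : δC * (((x + h) ^ β₁ - x ^ β₁) / β₁) ≤ δC * h := mul_le_mul_of_nonneg_left hIh hδC0.le
    have hΔup : ΔS ≤ 2 * (δC * h) + κ' * (δC * h) := by nlinarith [key.2]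
    rw [abs_le]; constructor <;> nlinarith [hsand.1, hsand.2, key.1, key.2, mul_pos hκ (mul_pos hδC0 hh0)]

end Summit.QuantumAdvantage.QuantumAdvantage.Theorems.DegreeOnePrimesEscape

end
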